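import Summits.Langlands.Langlands.Theses.IrreducibilityBySelfDuality
import Summits.Langlands.Langlands.Theorems.IrreducibilityBySelfDualityIrreducibleOffSectorRankTwoRational
import Summits.Langlands.Langlands.Theorems.IrreducibilityBySelfDualityIrreducibleOffSectorNoAbelianAvatar
import Summits.Langlands.Langlands.Theorems.IrreducibleOffSector.Negative.FalseWithoutPos
import Literature.NumberTheory.Automorphic.PairLFunctionPolesRepDataRankTwo
import HarnessLib

/-!
# Line `exact-weights-without-hecke-field` for the crux `IrreducibleOffSector` — crux-plan verdict:
# NO CONCLUDING SKELETON; checked SUPPORTS PACKAGE instead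
(crux stmt-Langlands-14329, `Summit.Langlands.Langlands.Theses.IrreducibilityBySelfDuality.IrreducibleOffSector`,
route `route-Langlands-IrreducibilityBySelfDuality`; crux-plan seat
planner-cruxplan-stmt-Langlands-14329-exact-weights-withou-0, 2026-08-17; idea card
`Ideas/exact-weights-without-hecke-field.md`, triage TRIAGE-r2-1/2/3 (pass ×3, all three: "support-grade
lever, NOT a by-name line; do not file K3/K4 as stubs of a closing skeleton").)

THIS FILE IS NOT A REGISTERED SKELETON: it contains no `stub_*` and no `IrreducibleOffSector_of`, and it
must not be fed to `ledger skeleton check`. Reason (Lines/exact-weights-without-hecke-field.md §2): every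
composition `S₁ → … → S_k → IrreducibleOffSector` built on this idea's lever needs a stub whose open
content contains O1 (an automorphy/converse statement for irreducible constituents of dimension
`2 … n-1` of an ARBITRARY compatible `ρ`, Sketch-dead.md §5) together with the abelian case over number
fields that are not totally real and pointwise arithmeticity of irregular `π` (K4) — i.e. a stub that is
the crux minus the region this lever closes (COSTUME / SHRED by the crux-plan rules), dead on arrival
exactly as line `Sketch` (5 lead seats c9–c13, 0 delegable stubs).

WHAT THE LEVER DOES GIVE (theorem-grade, every statement below elaborates; `sorry` only in the four
`target_*` declarations, which are `--supports stmt-Langlands-14329` TARGETS for a supports-size prover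
seat or the standing disprover, not line stubs):

* `target_not_charpoly_eq_prod_rank_one_of_pointwiseAlgebraic` (T-main, size L): for `K` TOTALLY REAL,
  `n ≥ 2`, `π` cuspidal on `GL_n(𝔸_K)` with POINTWISE-ALGEBRAIC Satake parameters at almost all places
  (no Hecke field, no regularity, no L-algebraicity), Arthur–Clozel (2.3) for pairs on `GL_n/K`
  (`PairLPoleAt n K hcpt`; a THEOREM for `n ≤ 2`), every `ℓ`, EVERY `ι` and every a.e.-compatible
  `ρ : Γ_K → GL_n(ℚ̄_ℓ)`: `det(X - ρ) ≠ ∏ᵢ det(X - χᵢ)` for every family of continuous characters `χᵢ`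
  — no abelian semisimplification, no triangularisable avatar. It sharpens the landed
  `not_charpoly_eq_prod_rank_one_of_esymm_mem` (p130708: needs the Hecke field `E`) on totally real `K`.
* its suggested stub chain, each typed: `target_exactSlope` (T-A, every `K`: Böckle–Hui Thm 2.2 —
  PROVED in tree for every `K`, `LogLinear.pow_isLocallyAlgebraic_of_frobenius_isAlgebraic` — plus the
  Hecke avatar and its unitary normalisation give an EXACT `ι`-slope `‖ι ψ(Frob_v)‖ = q_v^s`),
  `target_finiteOrder_of_unitSlope` (T-B, `K` totally real: unit slope + a.e.-algebraic Frobenius ⇒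
  finite order), `target_automorphicRigidity` (T-C, every `K`, purely automorphic: no cuspidal `π` on
  `GL_n`, `n ≥ 2`, has an indexed Satake family with exact real slopes whose equal-slope ratios are
  finite-order `GL(1)` data — slope lock by (2.1) + first moment, ghost cancellation + pole count by
  (2.3) against the rank-one theorems).
* PROVED here from T-main: `not_isUpperTriangular_conj_of_pointwiseAlgebraic` (no triangularisable
  avatar), `isIrreducible_rank_two_of_pointwiseAlgebraic` (rank two, UNCONDITIONAL: (2.3) in rank `≤ 2`
  is `JacquetShalika1981_partialPairL_pole_repData_rank_of_le_two`), and the crux-shaped slice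
  `cruxSlice_rank_two_totallyReal` (the binders of `IrreducibleOffSector` at `n = 2` with
  `[IsTotallyReal K]` and pointwise algebraicity added).

Guards honoured (Disproof.lean v1.1): `2 ≤ n` is load-bearing in T-main and T-C (at `n = 1` their
conclusions are false — `ψ` itself, resp. `|·|^{-s}` — while `crux_rank_one` holds; the `GL_0` witness
of `Negative.irreducibleOffSector_false_without_pos`, imported above, is excluded by it); T-A/T-B are
rank-one statements with no rank guard needed. No statement here is an instance of a landed Negative
lemma (Negative/FalseWithoutPos, Negative/IsobaricRigidityGuards) or of a `ledger negatives` entry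
(17212 GL_0 guard: fixed `n ≥ 2`; 16822, 3797 unrelated).
-/

noncomputable section

set_option linter.dupNamespace false

open scoped NumberField Classical Polynomial Topology
open Filter IsDedekindDomain Polynomial NumberField
open Literature.NumberTheory.Automorphic Literature.NumberTheory.GaloisRepresentations
open Summit.Langlands
open Summit.Langlands.Langlands.Theses.IrreducibilityBySelfDuality
open Summit.Langlands.Langlands.Theorems.IrreducibleOffSector

namespace Summit.Langlands.Langlands.Cruxes.IrreducibleOffSector.ExactWeightsWithoutHeckeField

/-! ## 0. Probes -/

/-- The crux, by name (elaboration probe; this file does NOT conclude it). [folklore] -/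
example : Prop := IrreducibleOffSector

/-- Arthur–Clozel (2.3) for pairs of cuspidal Borel–Jacquet data on `GL_n(𝔸_K)` at level `hcpt`:
the rank-`n`, field-`K` INSTANCE of the named fact `JacquetShalika1981_partialPairL_pole_repData`
(so that the rank-two corollaries below are unconditional). [cite: ArthurClozelAMS120, Ch. 3 §2 (2.3)] -/
def PairLPoleAt (n : ℕ) (K : Type) [Field K] [NumberField K]
    (hcpt : isCompact_glFiniteIntegralLevel n K) : Prop :=
  ∀ (π π' : CuspidalAutomorphicRepData n K hcpt),
    ∃ S₀ : Set (HeightOneSpectrum (𝓞 K)), S₀.Finite ∧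
      ∀ {S : Set (HeightOneSpectrum (𝓞 K))} (_hS : S.Finite) (_hS₀ : S₀ ⊆ S)
        {α β : SatakeFamily K} (_hα : ∀ w ∉ S, π.1.HasSatakeParamAt w (α w))
        (_hβ : ∀ w ∉ S, π'.1.HasSatakeParamAt w (β w))
        (_hu : ∀ w ∉ S, ‖(α w).prod‖ = 1) (_hu' : ∀ w ∉ S, ‖(β w).prod‖ = 1)
        {s₀ : ℂ} (_hs₀ : s₀.re = 1)
        (_hX : ∀ᶠ w in cofinite,
          (α w).map (((w.residueCard : ℂ) ^ (1 - s₀)) * ·) = (β w).map (·⁻¹)),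
        ∃ c : ℂ, c ≠ 0 ∧
          Tendsto (fun s => (s - s₀) * partialPairL S α β s) (𝓝[{s : ℂ | 1 < s.re}] s₀) (𝓝 c)

/-- The named fact (2.3) gives `PairLPoleAt` in every rank `n ≥ 1`. [cite: ArthurClozelAMS120, Ch. 3 §2 (2.3)] -/
theorem pairLPoleAt_of_fact (h23 : JacquetShalika1981_partialPairL_pole_repData)
    {n : ℕ} {K : Type} [Field K] [NumberField K] (hcpt : isCompact_glFiniteIntegralLevel n K)
    (hn : 0 < n) : PairLPoleAt n K hcpt :=
  fun π π' => h23 n K hcpt hn π π'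

/-- (2.3) in rank two is a THEOREM of the tree (`JacquetShalika1981_partialPairL_pole_repData_rank_of_le_two`).
[cite: ArthurClozelAMS120, Ch. 3 §2 (2.3)] -/
theorem pairLPoleAt_two {K : Type} [Field K] [NumberField K]
    (hcpt : isCompact_glFiniteIntegralLevel 2 K) : PairLPoleAt 2 K hcpt :=
  fun π π' => JacquetShalika1981_partialPairL_pole_repData_rank_of_le_two le_rfl hcpt two_pos π π'

/-! ## 1. The main target (T-main): no abelian semisimplification over totally real `K` from
POINTWISE algebraicity -/

/-- **T-main (target, size L; `--supports stmt-Langlands-14329`).** `K` totally real, `n ≥ 2`, `π`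
cuspidal on `GL_n(𝔸_K)` whose Satake parameters are algebraic numbers at almost every place (`halg`;
no Hecke field, no archimedean hypothesis), (2.3) for pairs on `GL_n/K` (`h23`). Then for every `ℓ`,
every field isomorphism `ι : ℚ̄_ℓ ≃ ℂ`, every `ρ : Γ_K → GL_n(ℚ̄_ℓ)` Satake–Frobenius compatible with
`(π, ι)` almost everywhere and every family of continuous characters `χᵢ : Γ_K → GL_1(ℚ̄_ℓ)`:
`det(X - ρ σ) ≠ ∏ᵢ det(X - χᵢ σ)` for some `σ`. Paper proof (NOTES-r2-k4.md §1, re-derived by the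
three triagers): (1) each `χᵢ` has a.e.-algebraic Frobenius values (roots of
`arithFrobPolyOfSatake ι q_v 1 α`), so `target_exactSlope` gives exact rational `ι`-slopes `sᵢ`;
(2) for `sᵢ = sⱼ`, `χᵢχⱼ⁻¹` has unit slope, hence finite order over totally real `K`
(`target_finiteOrder_of_unitSlope`) and is matched with a finite-order cuspidal `GL(1)` datum (Böckle–Hui
Thm 1.1 = tree theorem `WeakAbelianSummandHecke` applied to the character itself); (3) the Satake
family `{ι(χᵢ(Frob_v))⁻¹}ᵢ` then contradicts `target_automorphicRigidity`. The guard `2 ≤ n` is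
load-bearing (`n = 1`: take `χ₀` with `ρ`'s Frobenius data). Over CM `K` step (2) fails (weight-0
algebraic Hecke characters of infinite order: TRIAGE-r2-1 correction (b)), hence `[IsTotallyReal K]`.
[cite: BockleHui2025, Thm 2.2 and Thm 1.1] [cite: arXiv:2404.08954, Thm 2.2 p. 6]
[cite: SerreAbelianLadic1968, Ch. III §3] [cite: JacquetShalikaAJM1981II, Prop. 3.6 and Thm. 4.4]
[cite: ArthurClozelAMS120, Ch. 3 §2 (2.1)–(2.3)] -/
theorem target_not_charpoly_eq_prod_rank_one_of_pointwiseAlgebraic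
    {K : Type} [Field K] [NumberField K] [IsTotallyReal K] {n : ℕ} (hn : 2 ≤ n)
    {hcpt : isCompact_glFiniteIntegralLevel n K} (h23 : PairLPoleAt n K hcpt)
    (π : CuspidalAutomorphicRepData n K hcpt)
    (halg : ∀ᶠ v : HeightOneSpectrum (𝓞 K) in cofinite, ∀ α : Multiset ℂ,
      π.1.HasSatakeParamAt v α → ∀ a ∈ α, IsAlgebraic ℚ a)
    {ℓ : ℕ} [Fact ℓ.Prime] (ι : PadicAlgCl ℓ ≃+* ℂ) (ρ : FramedGaloisRep K (PadicAlgCl ℓ) n)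
    (hρ : ∀ᶠ v : HeightOneSpectrum (𝓞 K) in cofinite, SatakeFrobCompatibleAt ι π.1 ρ v)
    (χ : Fin n → FramedGaloisRep K (PadicAlgCl ℓ) 1) :
    ¬ ∀ σ, ρ.charpoly σ = ∏ i, (χ i).charpoly σ := by
  sorry

/-! ## 2. The suggested stub chain of T-main (each a genuine lemma; all typed) -/

/-- **T-A (target, size M/L; every number field `K`). Exact `ι`-slope of an almost locally algebraic
character.** A continuous `ψ : Γ_K → GL_1(ℚ̄_ℓ)` whose Frobenius values are algebraic over `ℚ` at
almost all places has, for each field isomorphism `ι : ℚ̄_ℓ ≃ ℂ`, an EXACT rational slope: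
`‖ι(ψ(Frob_v))‖ = q_v^s` at almost all `v`, one real `s` (in fact `s ∈ (1/2N)ℤ`; only the
EXISTENCE of an exact slope is load-bearing downstream, so `s : ℝ`). Proof route: the idelic avatar of `ψ`
(`FramedGaloisRep.exists_idelicCharacter_eventually`), Böckle–Hui Thm 2.2 for every `K` (tree theorem
`LogLinear.pow_isLocallyAlgebraic_of_frobenius_isAlgebraic`: `ψ^N` locally algebraic), the algebraic
Hecke character of `ψ^N` (LocallyAlgebraicHeckeCharacterProofs `heckeOfLocAlg`) and purity of algebraic
Hecke characters (`AlgebraicHeckeCharacterPurity`: `|τ χ(𝔞)| = N𝔞^{w/2}` for every complex embedding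
`τ`, applied to `τ = ι ∘ e`) — or, cheaper, the unitary normalisation of the attached `GL(1)` datum
(`CuspidalAutomorphicRepData.exists_satake_eq_cpow_mul_L2_holds` at `n = 1`: `t_χ(v) = q_v^c u_v`,
`|u_v| = 1`, whence `s = -re c / N` through the `ι`-dictionary `ι(ψ^N(Frob_v)) = c_v⁻¹` of
`arithFrobPolyOfSatake ι q_v 1 {c_v}`). The transcendence input (ℓ-adic six exponentials /
Waldschmidt) is entirely inside the tree theorem. [cite: BockleHui2025, Thm 2.2]
[cite: SerreAbelianLadic1968, Ch. II §3.4 and Ch. III §3] [cite: Waldschmidt1981, Part II] -/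
theorem target_exactSlope
    {K : Type} [Field K] [NumberField K] {ℓ : ℕ} [Fact ℓ.Prime] (ι : PadicAlgCl ℓ ≃+* ℂ)
    (ψ : FramedGaloisRep K (PadicAlgCl ℓ) 1)
    (halg : ∀ᶠ v : HeightOneSpectrum (𝓞 K) in cofinite, ψ.IsUnramifiedAt v ∧
      ∀ 𝔓 ∈ v.primesAbove, ∀ σ : Field.absoluteGaloisGroup K, IsArithFrobAt (𝓞 K) σ 𝔓 →
        IsAlgebraic ℚ ((((ψ σ : GL (Fin 1) (PadicAlgCl ℓ)) :
          Matrix (Fin 1) (Fin 1) (PadicAlgCl ℓ)) 0 0))) :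
    ∃ s : ℝ, ∀ᶠ v : HeightOneSpectrum (𝓞 K) in cofinite,
      ∀ 𝔓 ∈ v.primesAbove, ∀ σ : Field.absoluteGaloisGroup K, IsArithFrobAt (𝓞 K) σ 𝔓 →
        ‖ι ((((ψ σ : GL (Fin 1) (PadicAlgCl ℓ)) : Matrix (Fin 1) (Fin 1) (PadicAlgCl ℓ)) 0 0))‖ =
          (v.residueCard : ℝ) ^ s := by
  sorry

/-- **T-B (target, size M/L; `K` TOTALLY REAL). Unit slope and a.e.-algebraic Frobenius force finite
order.** For `K` totally real, a continuous `φ : Γ_K → GL_1(ℚ̄_ℓ)` with a.e.-algebraic Frobenius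
values and `‖ι(φ(Frob_v))‖ = 1` at almost all `v` (one `ι`) has finite order. Proof route: `φ^N` is
locally algebraic (Böckle–Hui 2.2, tree theorem for every `K`), i.e. the avatar of an algebraic Hecke
character `χ`; unit slope gives weight `0`; over a totally real field an algebraic infinity type is
PARALLEL (Artin–Weil: `HeckeCharacter.infinityType` lemmas of `HeckeCharacterArchType*`), so weight `0`
means trivial infinity type and `χ` has finite order `M`; then `φ^{NM}` is trivial at almost every
Frobenius, hence trivial (Chebotarev density for the abelian character, `chebotarev_artinRep_holds`,
and continuity). FALSE over CM `K` (type `z^a z̄^{-a}`): the hypothesis `[IsTotallyReal K]` is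
load-bearing. [cite: BockleHui2025, Thm 2.2] [cite: SerreAbelianLadic1968, Ch. III §3]
[cite: Weil1956, §"Grössencharaktere of type (A₀)"] -/
theorem target_finiteOrder_of_unitSlope
    {K : Type} [Field K] [NumberField K] [IsTotallyReal K] {ℓ : ℕ} [Fact ℓ.Prime]
    (ι : PadicAlgCl ℓ ≃+* ℂ) (φ : FramedGaloisRep K (PadicAlgCl ℓ) 1)
    (halg : ∀ᶠ v : HeightOneSpectrum (𝓞 K) in cofinite, φ.IsUnramifiedAt v ∧
      ∀ 𝔓 ∈ v.primesAbove, ∀ σ : Field.absoluteGaloisGroup K, IsArithFrobAt (𝓞 K) σ 𝔓 →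
        IsAlgebraic ℚ ((((φ σ : GL (Fin 1) (PadicAlgCl ℓ)) :
          Matrix (Fin 1) (Fin 1) (PadicAlgCl ℓ)) 0 0)))
    (hunit : ∀ᶠ v : HeightOneSpectrum (𝓞 K) in cofinite,
      ∀ 𝔓 ∈ v.primesAbove, ∀ σ : Field.absoluteGaloisGroup K, IsArithFrobAt (𝓞 K) σ 𝔓 →
        ‖ι ((((φ σ : GL (Fin 1) (PadicAlgCl ℓ)) : Matrix (Fin 1) (Fin 1) (PadicAlgCl ℓ)) 0 0))‖ = 1) :
    ∃ m : ℕ, 0 < m ∧ ∀ σ : Field.absoluteGaloisGroup K, (φ σ) ^ m = 1 := by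
  sorry

/-- **T-C (target, size L; every number field `K`; purely automorphic — the analytic heart).
Twisted finite-order rigidity of cuspidal Satake families.** Let `n ≥ 2`, `π` cuspidal on
`GL_n(𝔸_K)` with (2.3) for pairs on `GL_n/K`. There is NO indexed family `a : Fin n → (places → ℂ)`
with `{aᵢ(v)}ᵢ` the Satake parameter of `π` at almost every `v`, exact real slopes
`‖aᵢ(v)‖ = q_v^{sᵢ}` a.e., and, whenever `sᵢ = sⱼ`, `aᵢ(v) = cᵢⱼ(v)·aⱼ(v)` a.e. for the Satake values
`cᵢⱼ(v)` of a cuspidal `GL(1)` datum `ηᵢⱼ` of FINITE ORDER (a.e. `cᵢⱼ(v)^m = 1`). Paper proof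
(NOTES-r2-k4 §1 Steps 3–4; TRIAGE-r2-3 re-derivation): normalise `t_π = q^c t_P`, `P ⊂ L²_cusp` unitary
(`exists_satake_eq_cpow_mul_L2_holds`), so `Σ σᵢ = 0` for `σᵢ = sᵢ - re c`; SLOPE LOCK: if
`σ_max > 0`, on the top-slope block `I` the trace is `a_{i₀}(v)·A(v) + O(q_v^{σ'})` with
`A(v) = Σ_{i∈I} c_{i i₀}(v)` a sum of `|I|` roots of unity of bounded order containing `1`, and
`Σ_v |A(v)|² q_v^{-s} ≥ |I| log(1/(s-1)) + O(1)` by the RANK-ONE theorems (2.2)/(2.3)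
(`JacquetShalika1981_partialPairL_boundary_repData_one_one`, `…_pole_repData_one`), so `A(v) ≠ 0` on a
set with `Σ q_v^{-1} = ∞`, where `|tr t_P(v)|² ≫ q_v^{2σ_max}`; but every Euler factor of
`L^S(s, P × P̄)` is real `≥ exp(|tr t_P(v)|² q_v^{-s})` for real `s ∈ (2σ_max, 1 + 2σ_max]`, `s > 1`,
and the product converges by (2.1) (THEOREM `JacquetShalika1981_multipliable_partialPairL_repData_holds`)
— contradiction; so all slopes are equal. GHOST CANCELLATION: then `aᵢ = c_{i0}·a₀` for all `i`, the
common factor `a₀(v)` (slope AND unit part) cancels in `t_π ⊗ t_π̃ = {c_{i0} c_{j0}⁻¹(v)}`, so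
`L^S(s, π × π̃) = ∏_{i,j} L^S(s, η_{i0} × η̃_{j0})` (`satakePairPolynomial_sum_sum`, contragredient datum
`exists_contragredient_satake_holds`, shift bookkeeping `tendsto_sub_mul_partialPairL_of_shift`), whose
pole order at `s = 1` is `#{(i,j) : η_{i0} ≅ η_{j0}} ≥ n ≥ 2` by the rank-one theorems, against the
SIMPLE pole `h23`. Guard `2 ≤ n` load-bearing (`n = 1`: `π = |·|^{-s}`). Typing hazards for the prover:
the complex shift `c` (families of `π` itself are unitary only if `re c = 0` — use the `L²` form of
(2.1)/(2.3) on `P` or the shift lemmas); the conjugate/contragredient datum; `HasSatakeParamAt`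
uniqueness (`hasSatakeParamAt_unique_holds`) to identify `{aᵢ(v)}` with any Satake family off `S`.
[cite: JacquetShalikaAJM1981, Thm. 5.3] [cite: JacquetShalikaAJM1981II, Prop. 3.6 and Thm. 4.4]
[cite: ArthurClozelAMS120, Ch. 3 §2 (2.1)–(2.3)] -/
theorem target_automorphicRigidity
    {K : Type} [Field K] [NumberField K] {n : ℕ} (hn : 2 ≤ n)
    {hcpt : isCompact_glFiniteIntegralLevel n K} (h1 : isCompact_glFiniteIntegralLevel 1 K)
    (h23 : PairLPoleAt n K hcpt) (π : CuspidalAutomorphicRepData n K hcpt)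
    (a : Fin n → HeightOneSpectrum (𝓞 K) → ℂ)
    (ha : ∀ᶠ v : HeightOneSpectrum (𝓞 K) in cofinite,
      π.1.HasSatakeParamAt v ((Finset.univ : Finset (Fin n)).val.map fun i => a i v))
    (s : Fin n → ℝ)
    (hs : ∀ i, ∀ᶠ v : HeightOneSpectrum (𝓞 K) in cofinite, ‖a i v‖ = (v.residueCard : ℝ) ^ (s i))
    (η : Fin n → Fin n → CuspidalAutomorphicRepData 1 K h1)
    (hfin : ∀ i j, s i = s j → ∃ m : ℕ, 0 < m ∧ ∀ᶠ v : HeightOneSpectrum (𝓞 K) in cofinite,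
      ∀ c : ℂ, (η i j).1.HasSatakeParamAt v {c} → c ^ m = 1)
    (hratio : ∀ i j, s i = s j → ∀ᶠ v : HeightOneSpectrum (𝓞 K) in cofinite,
      ∃ c : ℂ, (η i j).1.HasSatakeParamAt v {c} ∧ a i v = c * a j v) :
    False := by
  sorry

/-! ## 3. Proved consequences of T-main (glue; sorry-free modulo the target) -/

/-- **No triangularisable avatar** of a cuspidal `π` with pointwise-algebraic Satake parameters over a
totally real field (`n ≥ 2`, (2.3) on `GL_n/K`, every `ℓ`, `ι`): no `P ∈ GL_n(ℚ̄_ℓ)` makes `P ρ P⁻¹`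
upper triangular (`exists_charpoly_eq_prod_of_isUpperTriangular`, p130538). From T-main.
[cite: BockleHui2025, Thm 2.2] [cite: JacquetShalikaAJM1981II, Prop. 3.6] -/
theorem not_isUpperTriangular_conj_of_pointwiseAlgebraic
    {K : Type} [Field K] [NumberField K] [IsTotallyReal K] {n : ℕ} (hn : 2 ≤ n)
    {hcpt : isCompact_glFiniteIntegralLevel n K} (h23 : PairLPoleAt n K hcpt)
    (π : CuspidalAutomorphicRepData n K hcpt)
    (halg : ∀ᶠ v : HeightOneSpectrum (𝓞 K) in cofinite, ∀ α : Multiset ℂ,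
      π.1.HasSatakeParamAt v α → ∀ a ∈ α, IsAlgebraic ℚ a)
    {ℓ : ℕ} [Fact ℓ.Prime] (ι : PadicAlgCl ℓ ≃+* ℂ) (ρ : FramedGaloisRep K (PadicAlgCl ℓ) n)
    (hρ : ∀ᶠ v : HeightOneSpectrum (𝓞 K) in cofinite, SatakeFrobCompatibleAt ι π.1 ρ v)
    (P : GL (Fin n) (PadicAlgCl ℓ)) : ¬ (ρ.conj P).IsUpperTriangular := by
  intro hT
  obtain ⟨χ, hχ⟩ := exists_charpoly_eq_prod_of_isUpperTriangular ρ P hT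
  exact target_not_charpoly_eq_prod_rank_one_of_pointwiseAlgebraic hn h23 π halg ι ρ hρ χ hχ

/-- **Rank two, UNCONDITIONAL modulo T-main: every compatible avatar is irreducible.** For `K`
totally real and EVERY cuspidal `π` on `GL_2(𝔸_K)` with pointwise-algebraic Satake parameters (any
infinity type; irregular Hilbert–Maass forms included), every `ρ : Γ_K → GL_2(ℚ̄_ℓ)` Satake–Frobenius
compatible with `(π, ι)` a.e. is irreducible: a reducible `ρ` has two diagonal characters
(`exists_blocks_of_not_isIrreducible_two`), excluded by T-main with (2.3) in rank two a theorem
(`pairLPoleAt_two`). Sharper than the landed `isIrreducible_rank_two_of_rational` (p117233: needs an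
`E`-rational avatar) on totally real `K`. [cite: BockleHui2025, Thm 2.2]
[cite: JacquetShalikaAJM1981II, Thm. 4.4] -/
theorem isIrreducible_rank_two_of_pointwiseAlgebraic
    {K : Type} [Field K] [NumberField K] [IsTotallyReal K]
    {hcpt : isCompact_glFiniteIntegralLevel 2 K} (π : CuspidalAutomorphicRepData 2 K hcpt)
    (halg : ∀ᶠ v : HeightOneSpectrum (𝓞 K) in cofinite, ∀ α : Multiset ℂ,
      π.1.HasSatakeParamAt v α → ∀ a ∈ α, IsAlgebraic ℚ a)
    {ℓ : ℕ} [Fact ℓ.Prime] (ι : PadicAlgCl ℓ ≃+* ℂ) (ρ : FramedGaloisRep K (PadicAlgCl ℓ) 2)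
    (hρ : ∀ᶠ v : HeightOneSpectrum (𝓞 K) in cofinite, SatakeFrobCompatibleAt ι π.1 ρ v) :
    ρ.toGaloisRep.IsIrreducible := by
  by_contra hρirr
  obtain ⟨A, D, hcp, -⟩ := exists_blocks_of_not_isIrreducible_two ρ hρirr
  refine target_not_charpoly_eq_prod_rank_one_of_pointwiseAlgebraic le_rfl (pairLPoleAt_two hcpt)
    π halg ι ρ hρ ![A, D] fun σ => ?_
  rw [hcp σ, Fin.prod_univ_two]
  rfl

/-- **The slice of the crux this lever closes, in the binders of `IrreducibleOffSector`** (modulo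
T-main): rank `n = 2`, `K` totally real, `π` cuspidal L-algebraic (L-algebraicity is NOT used) with
pointwise-algebraic Satake parameters at almost all places, every `ℓ`, `ι`, `ρ`. What it does NOT reach
(and why there is no `IrreducibleOffSector_of` here): `n ≥ 3` (O1: constituents of dimension
`2 … n-1`), `K` not totally real (the CM ghost-root gap), and pointwise arithmeticity itself (K4, the
pointwise shadow of Buzzard–Gee Conj. 3.1.6 — open for eigenvalue-¼ Maass forms).
[cite: arXiv:math/0609460, §0] [cite: BuzzardGeeLMS2014, Conj. 3.1.6] -/
theorem cruxSlice_rank_two_totallyReal :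
    ∀ (K : Type) [Field K] [NumberField K] [IsTotallyReal K]
      (hcpt : Literature.NumberTheory.Automorphic.isCompact_glFiniteIntegralLevel 2 K)
      (π : Literature.NumberTheory.Automorphic.CuspidalAutomorphicRepData 2 K hcpt), π.1.IsLAlgebraic →
      (∀ᶠ v : IsDedekindDomain.HeightOneSpectrum (NumberField.RingOfIntegers K) in cofinite,
        ∀ α : Multiset ℂ, π.1.HasSatakeParamAt v α → ∀ a ∈ α, IsAlgebraic ℚ a) →
      ∀ (ℓ : ℕ) [Fact ℓ.Prime] (ι : PadicAlgCl ℓ ≃+* ℂ)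
        (ρ : Literature.NumberTheory.GaloisRepresentations.FramedGaloisRep K (PadicAlgCl ℓ) 2),
        (∀ᶠ v : IsDedekindDomain.HeightOneSpectrum (NumberField.RingOfIntegers K) in cofinite,
          SatakeFrobCompatibleAt ι π.1 ρ v) →
        ρ.toGaloisRep.IsIrreducible :=
  fun _K _ _ _ _hcpt π _hL halg _ℓ _ ι ρ hρ => isIrreducible_rank_two_of_pointwiseAlgebraic π halg ι ρ hρ

end Summit.Langlands.Langlands.Cruxes.IrreducibleOffSector.ExactWeightsWithoutHeckeField

end
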